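import Literature.NumberTheory.LFunctions.WeilFirstPrimeCertificateZ
import HarnessLib

/-!
# Transfer of a kernel-checked moment table between Stage-C certificates of different half-length

Topic: `Literature/NumberTheory/LFunctions`. In the Stage-C first-prime certificate format
(`WeilCert3`, `WeilFirstPrimeCertificateZ.lean`) the moment check `checkNuAt q` compares the claimed
scaled moment `ν̃_q` with `nuScale · ν_q`, `ν_q = a₀^q · 2 · cellsMomentQ₂ wL cells q`. The cell moments
do not depend on `a₀`, so a table checked (expensively, by the kernel) for one certificate `c₀`
transfers to any certificate `c` with the same level and cells at another half-length by rescaling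
with `r^q`, `r = a₀(c)/a₀(c₀)`, at the price of a test on literals:
**`WeilCert3.checkNuAt_of_scaled`**. Used by the odd-sector margin certificates
(`WeilFirstPrimeOddMarginData*.lean`), which reuse the cells of `weilCert3C`. Pure bookkeeping; proved.
-/

namespace Literature.NumberTheory.LFunctions

namespace WeilCert3

/-- Moments of two Stage-C certificates with the same level and cells differ by the factor
`(a₀/a₀')^q`. [folklore] -/
theorem nuQ_eq_mul_of_cells_eq (c c₀ : WeilCert3) (q : ℕ) (hcells : c.cells = c₀.cells)
    (hwL : c.base.wL = c₀.base.wL) (ha : c₀.base.a0 ≠ 0) :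
    c.nuQ q = (c.base.a0 / c₀.base.a0) ^ q * c₀.nuQ q := by
  unfold WeilCert3.nuQ
  rw [hcells, hwL, div_pow, div_mul_eq_mul_div, eq_div_iff (pow_ne_zero q ha)]
  ring

/-- **Transfer of a checked moment entry.** If `c` reuses the level and cells of `c₀`, entry `q` of
`c₀`'s table is within `2^{-pnu(c₀)}` of `nuScale · ν_q(a₀(c₀))` (`c₀.checkNuAt q`), and the claimed entry
of `c` passes `|ν̃'_q − r^q ν̃_q| + r^q 2^{-pnu(c₀)} ≤ 2^{-pnu(c)}` with `r = a₀(c)/a₀(c₀) ≥ 0`, then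
`c.checkNuAt q` holds (triangle inequality). [folklore] -/
theorem checkNuAt_of_scaled (c c₀ : WeilCert3) (q : ℕ) (hcells : c.cells = c₀.cells)
    (hwL : c.base.wL = c₀.base.wL) (h0 : c₀.checkNuAt q = true)
    (hlit : |getV c.nuData q - (c.base.a0 / c₀.base.a0) ^ q * getV c₀.nuData q| +
        (c.base.a0 / c₀.base.a0) ^ q * (1 / 2 ^ c₀.pnu) ≤ 1 / 2 ^ c.pnu)
    (hr : 0 ≤ c.base.a0 / c₀.base.a0) (ha : c₀.base.a0 ≠ 0) :
    c.checkNuAt q = true := by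
  unfold WeilCert3.checkNuAt at h0 ⊢
  rw [decide_eq_true_eq] at h0 ⊢
  set r : ℚ := c.base.a0 / c₀.base.a0 with hr_def
  have hr0 : 0 ≤ r ^ q := pow_nonneg hr q
  rw [nuQ_eq_mul_of_cells_eq c c₀ q hcells hwL ha, ← hr_def]
  set ν := getV c₀.nuData q
  set ν' := getV c.nuData q
  set m := c₀.nuQ q
  have h1 : |r ^ q * ν - nuScale * (r ^ q * m)| ≤ r ^ q * (1 / 2 ^ c₀.pnu) := by
    rw [show r ^ q * ν - nuScale * (r ^ q * m) = r ^ q * (ν - nuScale * m) by ring, abs_mul,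
      abs_of_nonneg hr0]
    exact mul_le_mul_of_nonneg_left h0 hr0
  calc |ν' - nuScale * (r ^ q * m)|
      = |(ν' - r ^ q * ν) + (r ^ q * ν - nuScale * (r ^ q * m))| := by ring_nf
    _ ≤ |ν' - r ^ q * ν| + |r ^ q * ν - nuScale * (r ^ q * m)| := abs_add_le _ _
    _ ≤ |ν' - r ^ q * ν| + r ^ q * (1 / 2 ^ c₀.pnu) := by linarith
    _ ≤ 1 / 2 ^ c.pnu := hlit

end WeilCert3

end Literature.NumberTheory.LFunctions
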